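import Literature.MathematicalPhysics.KineticTheory.FluctuationSpace
import Literature.MathematicalPhysics.KineticTheory.InfiniteChainDynamics
import HarnessLib

/-!
# Doyon's zero-wavenumber Hilbert space `ℋ₀(μ)` of the infinite oscillator chain

Topic `Literature/MathematicalPhysics/KineticTheory`; definition request `defn-ZeroWavenumberSpace`
(wanted by `stmt-AtomisticToContinuum-3228`, crux MourreAtZero of route DrudeMourre; also the home of
Drude weights / hydrodynamic projections for the cards herglotz-current-spectral-measure,
no-hidden-charges-hydro-projection, charges-are-collision-invariants).

This is the LATTICE INSTANCE `G = ℤ`, `ν = count` of the general construction of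
`Literature.MathematicalPhysics.KineticTheory.FluctuationSpace` (Spohn's fluctuation space; that file
names this request as its sibling), specialised to the phase space `ChainConfig = ℤ → ℝ × ℝ` of the
infinite chain `P : OscillatorChain` with an infinite-volume dynamics `D : InfiniteChainDynamics P`
(`Literature.MathematicalPhysics.KineticTheory.InfiniteChainDynamics`).

## The construction (Doyon 2022 §3–§5 for quantum chains; here classical)

For a translation-invariant probability measure `μ` on `ChainConfig` and a space `𝒱` of local
observables with summable connected correlations, Doyon's sesquilinear form at wavenumber `0` is
`⟨a, b⟩₀ = Σ_{x ∈ ℤ} Cov_μ(a, b ∘ τ_x)` (Doyon 2022 eq. (4.3) at `k = 0`; Spohn 1991 Part II (2.31)),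
`ℋ₀` is the completion of `𝒱` modulo null vectors (Doyon §4.3), `a ↦ [a]` the class map, and a
`μ`-preserving dynamics commuting with the shifts acts by unitaries `U_t [a] = [a ∘ φ_t]`
(Doyon Thm 4.11); the conserved space is `𝒬₀ = {ψ | U_t ψ = ψ}` (Doyon (4.24)) and the hydrodynamic
projection `ℙ` is the orthogonal projection onto it (Doyon Thm 5.1), the Drude weights being
`D_ab = ⟨ℙ a, ℙ b⟩₀`.

## Contents

* §1 Lattice structure of `ChainConfig`: the shift action `chainShift` (`(τ_x σ)_i = σ_{i+x}`, a
  `ShiftAction ℤ ChainConfig`), momentum reversal `chainReversal` (`(q, p) ↦ (q, -p)` sitewise), the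
  symmetric energy density `OscillatorChain.energyDensityZ`
  (`h_x = ½p_x² + U(q_x) + ½[V(q_{x+1} - q_x) + V(q_x - q_{x-1})]`), and PROVED covariance lemmas:
  `j_0 ∘ τ_x = j_x`, `h_0 ∘ τ_x = h_x`, `j ∘ R = -j`, `h ∘ R = h`, shift/reversal covariance of the
  equations of motion (`IsSolution.chainShift`, `IsSolution.chainReversal`), hence
  `φ_t ∘ τ_x = τ_x ∘ φ_t` and `φ_t ∘ R = R ∘ φ_{-t}` on a shift- and reversal-invariant carrier by
  uniqueness (`InfiniteChainDynamics.flow_chainShift`, `flow_chainReversal`), and the local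
  conservation law `d/dt h_x = j_{x-1} - j_x` along solutions (`IsSolution.hasDerivAt_energyDensityZ`).
* §2 General additions to `FluctuationDynamics` (any `G`): evenness `⟪ψ, U_{-t} ψ⟫ = ⟪ψ, U_t ψ⟫`,
  positive-definiteness of `t ↦ ⟪ψ, U_t ψ⟫` (the two Bochner inputs of DrudeDissolution), the
  hydrodynamic projection `hydroProjection = P_{𝒬₀}` and the Drude weight `drudeWeight ψ = ‖P_{𝒬₀} ψ‖²`.
* §3 The hypothesis structure `ZeroWavenumberData P D` (state `μ` + local observables `𝒱` ∋ `j_0, h_0`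
  + summable clustering + stationarity/homogeneity of `D`), its `FluctuationDynamics`, the space
  `ZeroWavenumberSpace Z = ℋ₀`, `form_eq_tsum` (`⟨a, b⟩₀ = Σ_x Cov_μ(a, b ∘ τ_x)`), the classes
  `currentClass = [J]`, `energyClass = [h]`, the Koopman group `koopman t = U_t` with
  `U_t [J] = [J ∘ φ_t]`, the identity `⟪[J], U_t [J]⟫₀ = D.currentCorrelation μ t` (given `⟨j_0⟩_μ = 0`,
  automatic under momentum-reversal symmetry), and the momentum-reversal operator `Θ` with
  `Θ U_t = U_{-t} Θ`, `Θ [J] = -[J]`, `Θ [h] = [h]`, `Θ² = 1`.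

## What is NOT here (and why)

* Positivity of `⟨a, a⟩₀` and strong continuity of `U_t` / Stone's theorem are exactly as in
  `FluctuationSpace`: positivity is the field `form_self_nonneg` (Doyon Lemma 4.5, a Følner average),
  strong continuity is not asserted (`IsStronglyContinuous` is a predicate), `generator` is the strong
  derivative at `0` (Doyon (4.9)), which is Stone's `𝓛♮` when `U` is strongly continuous.
* No Gibbs state, clustering estimate or infinite-volume flow is constructed: they are the DATA of a
  `ZeroWavenumberData` (space-time summable clustering at fixed `t` needs finite-speed estimates of
  Marchioro–Pellegrinotti–Pulvirenti / Buttà–Caglioti–Di Ruzza–Marchioro type plus mixing of the 1-D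
  Gibbs state — the analytic content of the requesting crux, not of a definition).
* Conservation of `[h]` in `ℋ₀` (`U_t [h] = [h]`) is only a predicate (`EnergyConserved`): it needs the
  exchange of the class map with the time integral of the proved pointwise law `ḣ_x = j_{x-1} - j_x`,
  i.e. continuity of `s ↦ [j ∘ φ_s]`, which is not part of the data.
* Scalars are real (Mathlib's covariance is real); complexify downstream for spectral calculus.
-/

noncomputable section

open MeasureTheory ProbabilityTheory Filter Topology Set Function
open scoped InnerProductSpace

namespace Literature.MathematicalPhysics.KineticTheory

/-! ## §1. Lattice translations, momentum reversal, local observables of the chain -/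

namespace HeatConduction

/-- **Lattice translations** of chain configurations, `(τ_x σ)_i = σ_{i+x}`, as a measurable action of
`ℤ` on `ChainConfig` (so that `a ∘ τ_x` is the observable `a` translated to `x`: `j_0 ∘ τ_x = j_x`;
Doyon 2022 §3.1, the space translations `ι_x`). [cite: Doyon2022, §3.1] -/
def chainShift : ShiftAction ℤ ChainConfig where
  toFun x σ := fun i => σ (i + x)
  measurable_toFun x := measurable_pi_lambda _ fun i => measurable_pi_apply (i + x)
  map_zero := by
    funext σ i
    simp
  map_add x y := by
    funext σ i
    simp only [comp_apply]
    exact congrArg σ (add_assoc i x y).symm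

/-- `(τ_x σ)_i = σ_{i+x}`. [folklore] -/
@[simp] theorem chainShift_apply (x : ℤ) (σ : ChainConfig) (i : ℤ) : chainShift x σ i = σ (i + x) :=
  rfl

/-- **Momentum reversal** `R : (q_i, p_i)_i ↦ (q_i, -p_i)_i` of chain configurations (the time-reversal
symmetry of Hamiltonian chains). [folklore] -/
def chainReversal (σ : ChainConfig) : ChainConfig := fun i => ((σ i).1, -(σ i).2)

/-- `(R σ)_i = (q_i, -p_i)`. [folklore] -/
@[simp] theorem chainReversal_apply (σ : ChainConfig) (i : ℤ) :
    chainReversal σ i = ((σ i).1, -(σ i).2) := rfl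

/-- `R` is an involution. [folklore] -/
@[simp] theorem chainReversal_chainReversal (σ : ChainConfig) :
    chainReversal (chainReversal σ) = σ := by
  funext i
  simp

/-- `R ∘ R = id`. [folklore] -/
theorem chainReversal_comp_chainReversal : chainReversal ∘ chainReversal = id :=
  funext chainReversal_chainReversal

/-- `R` is measurable. [folklore] -/
theorem measurable_chainReversal : Measurable chainReversal :=
  measurable_pi_lambda _ fun i =>
    (measurable_pi_apply i).fst.prodMk (measurable_pi_apply i).snd.neg

/-- `R` as a measurable equivalence of `ChainConfig` (its own inverse). [folklore] -/
def chainReversalEquiv : ChainConfig ≃ᵐ ChainConfig where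
  toFun := chainReversal
  invFun := chainReversal
  left_inv := chainReversal_chainReversal
  right_inv := chainReversal_chainReversal
  measurable_toFun := measurable_chainReversal
  measurable_invFun := measurable_chainReversal

/-- The measurable equivalence is `R`. [folklore] -/
@[simp] theorem coe_chainReversalEquiv : ⇑chainReversalEquiv = chainReversal := rfl

/-- `R` is a measurable embedding. [folklore] -/
theorem measurableEmbedding_chainReversal : MeasurableEmbedding chainReversal :=
  chainReversalEquiv.measurableEmbedding

/-- `R` commutes with the translations (exactly). [folklore] -/
theorem chainReversal_comp_chainShift (x : ℤ) :
    chainReversal ∘ chainShift x = chainShift x ∘ chainReversal := rfl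

namespace OscillatorChain

variable (P : OscillatorChain)

/-- The **energy density at site `x`** of the infinite chain, bond energies split evenly between
their endpoints: `h_x = ½ p_x² + U(q_x) + ½ [V(q_{x+1} - q_x) + V(q_x - q_{x-1})]`, the density whose
local conservation law `ḣ_x = j_{x-1} - j_x` holds with the bond current `bondCurrentZ`
(`IsSolution.hasDerivAt_energyDensityZ`; Bonetto–Lebowitz–Rey-Bellet 2000 §5.2, the local energy
and its current (23)). [cite: BonettoLebowitzReyBellet2000, §5.2 eq. (23)] -/
def energyDensityZ (σ : ChainConfig) (x : ℤ) : ℝ :=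
  (σ x).2 ^ 2 / 2 + P.U (σ x).1 +
    (P.V ((σ (x + 1)).1 - (σ x).1) + P.V ((σ x).1 - (σ (x - 1)).1)) / 2

/-- Translation covariance of the bond current: `j_y(τ_x σ) = j_{y+x}(σ)`. [folklore] -/
theorem bondCurrentZ_chainShift (σ : ChainConfig) (x y : ℤ) :
    P.bondCurrentZ (chainShift x σ) y = P.bondCurrentZ σ (y + x) := by
  simp only [bondCurrentZ, chainShift_apply, add_right_comm y 1 x]

/-- `j_0 ∘ τ_x = j_x`. [folklore] -/
theorem bondCurrentZ_comp_chainShift (x : ℤ) :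
    (fun σ => P.bondCurrentZ σ 0) ∘ chainShift x = fun σ => P.bondCurrentZ σ x := by
  funext σ
  simp only [comp_apply, bondCurrentZ_chainShift, zero_add]

/-- Translation covariance of the energy density: `h_y(τ_x σ) = h_{y+x}(σ)`. [folklore] -/
theorem energyDensityZ_chainShift (σ : ChainConfig) (x y : ℤ) :
    P.energyDensityZ (chainShift x σ) y = P.energyDensityZ σ (y + x) := by
  simp only [energyDensityZ, chainShift_apply, add_right_comm y 1 x, sub_add_eq_add_sub]

/-- `h_0 ∘ τ_x = h_x`. [folklore] -/
theorem energyDensityZ_comp_chainShift (x : ℤ) :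
    (fun σ => P.energyDensityZ σ 0) ∘ chainShift x = fun σ => P.energyDensityZ σ x := by
  funext σ
  simp only [comp_apply, energyDensityZ_chainShift, zero_add]

/-- The bond current is odd under momentum reversal: `j_x(R σ) = -j_x(σ)`. [folklore] -/
theorem bondCurrentZ_chainReversal (σ : ChainConfig) (x : ℤ) :
    P.bondCurrentZ (chainReversal σ) x = -P.bondCurrentZ σ x := by
  simp only [bondCurrentZ, chainReversal_apply]
  ring

/-- The energy density is even under momentum reversal: `h_x(R σ) = h_x(σ)`. [folklore] -/
theorem energyDensityZ_chainReversal (σ : ChainConfig) (x : ℤ) :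
    P.energyDensityZ (chainReversal σ) x = P.energyDensityZ σ x := by
  simp only [energyDensityZ, chainReversal_apply, neg_sq]

/-- Translation covariance of the forces: `F_i(τ_x σ) = F_{i+x}(σ)`. [folklore] -/
theorem force_chainShift (σ : ChainConfig) (x i : ℤ) :
    P.force (chainShift x σ) i = P.force σ (i + x) := by
  simp only [force, interactionForce, chainShift_apply, add_right_comm i 1 x, sub_add_eq_add_sub]

/-- The forces depend on positions only: `F_i(R σ) = F_i(σ)`. [folklore] -/
theorem force_chainReversal (σ : ChainConfig) (i : ℤ) :
    P.force (chainReversal σ) i = P.force σ i := by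
  simp only [force, interactionForce, chainReversal_apply]

variable {P}

/-- **The equations of motion are translation covariant**: if `γ` solves (1a)–(1b) then so does
`t ↦ τ_x γ(t)`. [folklore] -/
theorem IsSolution.chainShift {γ : ℝ → ChainConfig} (hγ : P.IsSolution γ) (x : ℤ) :
    P.IsSolution fun t => HeatConduction.chainShift x (γ t) := by
  intro i t
  obtain ⟨h1, h2⟩ := hγ (i + x) t
  exact ⟨by simpa using h1, by simpa [force_chainShift] using h2⟩

/-- **The equations of motion are reversible**: if `γ` solves (1a)–(1b) then so does
`t ↦ R γ(-t)`. [folklore] -/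
theorem IsSolution.chainReversal {γ : ℝ → ChainConfig} (hγ : P.IsSolution γ) :
    P.IsSolution fun t => HeatConduction.chainReversal (γ (-t)) := by
  intro i t
  obtain ⟨h1, h2⟩ := hγ i (-t)
  refine ⟨?_, ?_⟩
  · have h := h1.comp (x := t) (hasDerivAt_neg (x := t))
    simp only [mul_neg, mul_one] at h
    simpa [comp_def] using h
  · have h := (h2.comp (x := t) (hasDerivAt_neg (x := t))).neg
    simp only [mul_neg, mul_one, neg_neg] at h
    refine HasDerivAt.congr_deriv (h.congr_of_eventuallyEq (Eventually.of_forall fun s => ?_)) ?_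
    · simp [comp_def]
    · simp [force_chainReversal]

/-- **Local conservation of energy** along solutions of (1a)–(1b), for differentiable `U, V`:
`d/dt h_x(γ(t)) = j_{x-1}(γ(t)) - j_x(γ(t))` — the energy density `energyDensityZ` and the bond
current `bondCurrentZ` are compatible (BLR 2000 §5.2: `dh_i/dt = j_{i-1} - j_i` defines the
current (23)). [cite: BonettoLebowitzReyBellet2000, §5.2 eq. (23)] -/
theorem IsSolution.hasDerivAt_energyDensityZ {γ : ℝ → ChainConfig} (hγ : P.IsSolution γ)
    (hU : Differentiable ℝ P.U) (hV : Differentiable ℝ P.V) (x : ℤ) (t : ℝ) :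
    HasDerivAt (fun s => P.energyDensityZ (γ s) x)
      (P.bondCurrentZ (γ t) (x - 1) - P.bondCurrentZ (γ t) x) t := by
  obtain ⟨hq, hp⟩ := hγ x t
  obtain ⟨hq1, -⟩ := hγ (x + 1) t
  obtain ⟨hq0, -⟩ := hγ (x - 1) t
  have hkin := (hp.fun_pow 2).div_const (2 : ℝ)
  have hpin : HasDerivAt (fun s => P.U (γ s x).1) (deriv P.U (γ t x).1 * (γ t x).2) t :=
    (hU _).hasDerivAt.comp (x := t) hq
  have hb1 : HasDerivAt (fun s => P.V ((γ s (x + 1)).1 - (γ s x).1))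
      (deriv P.V ((γ t (x + 1)).1 - (γ t x).1) * ((γ t (x + 1)).2 - (γ t x).2)) t :=
    (hV _).hasDerivAt.comp (x := t) (hq1.sub hq)
  have hb0 : HasDerivAt (fun s => P.V ((γ s x).1 - (γ s (x - 1)).1))
      (deriv P.V ((γ t x).1 - (γ t (x - 1)).1) * ((γ t x).2 - (γ t (x - 1)).2)) t :=
    (hV _).hasDerivAt.comp (x := t) (hq.sub hq0)
  have hsum := (hkin.add hpin).add ((hb1.add hb0).div_const 2)
  refine HasDerivAt.congr_deriv (hsum.congr_of_eventuallyEq (Eventually.of_forall fun s => ?_)) ?_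
  · simp only [energyDensityZ, Pi.add_apply]
  · simp only [bondCurrentZ, force_eq, sub_add_cancel, Nat.cast_ofNat]
    ring

end OscillatorChain

namespace InfiniteChainDynamics

variable {P : OscillatorChain} (D : InfiniteChainDynamics P)

/-- **The flow commutes with the translations** on a shift-invariant carrier (uniqueness of
solutions within the carrier + translation covariance of the equations): `φ_t (τ_x σ) = τ_x (φ_t σ)`
(Doyon 2022 §3.1 eq. (3.3), homogeneity `ι_x τ_t = τ_t ι_x`, here derived). [cite: Doyon2022, §3.1 eq. (3.3)] -/
theorem flow_chainShift (hcar : ∀ x : ℤ, MapsTo (chainShift x) D.carrier D.carrier)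
    {σ : ChainConfig} (hσ : σ ∈ D.carrier) (t : ℝ) (x : ℤ) :
    D.flow t (chainShift x σ) = chainShift x (D.flow t σ) := by
  have h := D.unique (fun s => chainShift x (D.flow s σ)) (fun s => hcar x (D.flow_mem hσ s))
    ((D.isSolution σ hσ).chainShift x) t
  simp only [D.flow_zero σ hσ] at h
  exact h.symm

/-- A.e. form: if `μ` is carried by a shift-invariant carrier then `φ_t ∘ τ_x = τ_x ∘ φ_t` `μ`-a.e.
(the homogeneity field of `ZeroWavenumberData`). [folklore] -/
theorem flow_comp_chainShift_ae (hcar : ∀ x : ℤ, MapsTo (chainShift x) D.carrier D.carrier)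
    {μ : Measure ChainConfig} (hμ : ∀ᵐ σ ∂μ, σ ∈ D.carrier) (t : ℝ) (x : ℤ) :
    D.flow t ∘ chainShift x =ᵐ[μ] chainShift x ∘ D.flow t := by
  filter_upwards [hμ] with σ hσ
  exact D.flow_chainShift hcar hσ t x

/-- **Time reversal**: on a reversal-invariant carrier, `φ_t (R σ) = R (φ_{-t} σ)` (uniqueness +
reversibility of the equations). [folklore] -/
theorem flow_chainReversal (hcar : MapsTo chainReversal D.carrier D.carrier)
    {σ : ChainConfig} (hσ : σ ∈ D.carrier) (t : ℝ) :
    D.flow t (chainReversal σ) = chainReversal (D.flow (-t) σ) := by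
  have h := D.unique (fun s => chainReversal (D.flow (-s) σ)) (fun s => hcar (D.flow_mem hσ (-s)))
    (D.isSolution σ hσ).chainReversal t
  simp only [neg_zero, D.flow_zero σ hσ] at h
  exact h.symm

/-- A.e. form: if `μ` is carried by a reversal-invariant carrier then `R ∘ φ_t = φ_{-t} ∘ R` `μ`-a.e.
(the field `reversal_flow` of `ZeroWavenumberData.HasMomentumReversal`). [folklore] -/
theorem chainReversal_comp_flow_ae (hcar : MapsTo chainReversal D.carrier D.carrier)
    {μ : Measure ChainConfig} (hμ : ∀ᵐ σ ∂μ, σ ∈ D.carrier) (t : ℝ) :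
    chainReversal ∘ D.flow t =ᵐ[μ] D.flow (-t) ∘ chainReversal := by
  filter_upwards [hμ] with σ hσ
  simp only [comp_apply, D.flow_chainReversal hcar hσ, neg_neg]

end InfiniteChainDynamics

end HeatConduction

/-! ## §2. General additions to `FluctuationDynamics`: evenness, positive-definiteness, `P_{𝒬₀}` -/

namespace FluctuationDynamics

variable {G Ω : Type*} [AddCommGroup G] [MeasurableSpace G] [MeasurableSpace Ω]
  {ν : Measure G} {T : ShiftAction G Ω} (D : FluctuationDynamics ν T)
  [MeasurableNeg G] [ν.IsNegInvariant]

/-- `⟪U_s ψ, U_t φ⟫ = ⟪ψ, U_{t-s} φ⟫` (unitarity and the group law). [folklore] -/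
theorem inner_koopman_koopman_sub (s t : ℝ) (ψ φ : D.FluctuationSpace) :
    ⟪D.koopman s ψ, D.koopman t φ⟫_ℝ = ⟪ψ, D.koopman (t - s) φ⟫_ℝ := by
  have e : s + (t - s) = t := by ring
  have h := D.inner_koopman_koopman s ψ (D.koopman (t - s) φ)
  rw [← D.koopman_add_apply, e] at h
  exact h

/-- **Evenness of autocorrelations**: `⟪ψ, U_{-t} ψ⟫ = ⟪ψ, U_t ψ⟫` (real Hilbert space, `U_t`
orthogonal) — the current autocorrelation `C(t)` is even. [folklore] -/
theorem inner_koopman_neg_apply (t : ℝ) (ψ : D.FluctuationSpace) :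
    ⟪ψ, D.koopman (-t) ψ⟫_ℝ = ⟪ψ, D.koopman t ψ⟫_ℝ := by
  rw [← D.inner_koopman_koopman t ψ (D.koopman (-t) ψ), ← D.koopman_add_apply, add_neg_cancel,
    D.koopman_zero_apply, real_inner_comm]

/-- **Positive-definiteness of autocorrelations**: `Σ_{i,j} c_i c_j ⟪ψ, U_{t_j - t_i} ψ⟫ =
‖Σ_i c_i U_{t_i} ψ‖² ≥ 0` — with evenness, the hypothesis of Bochner's theorem for
`t ↦ ⟪ψ, U_t ψ⟫` (the current spectral measure of DrudeDissolution). [folklore] -/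
theorem sum_mul_inner_koopman_nonneg {ι : Type*} (s : Finset ι) (c : ι → ℝ) (t : ι → ℝ)
    (ψ : D.FluctuationSpace) :
    0 ≤ ∑ i ∈ s, ∑ j ∈ s, c i * c j * ⟪ψ, D.koopman (t j - t i) ψ⟫_ℝ := by
  have h : ∑ i ∈ s, ∑ j ∈ s, c i * c j * ⟪ψ, D.koopman (t j - t i) ψ⟫_ℝ =
      ⟪∑ i ∈ s, c i • D.koopman (t i) ψ, ∑ j ∈ s, c j • D.koopman (t j) ψ⟫_ℝ := by
    rw [sum_inner]
    refine Finset.sum_congr rfl fun i _ => ?_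
    rw [inner_sum]
    refine Finset.sum_congr rfl fun j _ => ?_
    rw [real_inner_smul_left, real_inner_smul_right, inner_koopman_koopman_sub]
    ring
  rw [h]
  exact real_inner_self_nonneg

/-- `𝒬₀` is complete (closed in the Hilbert space `ℋ`), so it has an orthogonal projection. [folklore] -/
instance completeSpace_conservedSpace : CompleteSpace D.conservedSpace :=
  D.isClosed_conservedSpace.completeSpace_coe

/-- **The hydrodynamic projection `ℙ = P_{𝒬₀}`**: orthogonal projection of `ℋ` onto the (closed)
conserved space `𝒬₀ = {ψ | U_t ψ = ψ ∀ t}` (Doyon 2022 §5.1, the projection `ℙ : ℋ₀ → 𝒬₀` of the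
Drude-weight and Euler-scale projection formulae, Thm 5.1). [cite: Doyon2022, §5.1 Thm 5.1] -/
def hydroProjection : D.FluctuationSpace →L[ℝ] D.FluctuationSpace := D.conservedSpace.starProjection

/-- `ℙ ψ ∈ 𝒬₀`. [folklore] -/
theorem hydroProjection_mem (ψ : D.FluctuationSpace) : D.hydroProjection ψ ∈ D.conservedSpace :=
  D.conservedSpace.starProjection_apply_mem ψ

/-- `ℙ ψ = ψ` for `ψ ∈ 𝒬₀`. [folklore] -/
theorem hydroProjection_eq_self {ψ : D.FluctuationSpace} (h : ψ ∈ D.conservedSpace) :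
    D.hydroProjection ψ = ψ :=
  Submodule.starProjection_eq_self_iff.2 h

/-- `ℙ` is idempotent. [folklore] -/
theorem hydroProjection_hydroProjection (ψ : D.FluctuationSpace) :
    D.hydroProjection (D.hydroProjection ψ) = D.hydroProjection ψ :=
  D.hydroProjection_eq_self (D.hydroProjection_mem ψ)

/-- `U_t ℙ = ℙ`: the range of `ℙ` is invariant. [folklore] -/
theorem koopman_hydroProjection (t : ℝ) (ψ : D.FluctuationSpace) :
    D.koopman t (D.hydroProjection ψ) = D.hydroProjection ψ :=
  D.hydroProjection_mem ψ t

/-- `ℙ ψ = 0` iff `ψ ⊥ 𝒬₀` ("no overlap with any conserved charge"). [folklore] -/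
theorem hydroProjection_eq_zero_iff (ψ : D.FluctuationSpace) :
    D.hydroProjection ψ = 0 ↔ ψ ∈ D.conservedSpaceᗮ :=
  Submodule.starProjection_apply_eq_zero_iff D.conservedSpace

/-- **The (diagonal) Drude weight** of `ψ ∈ ℋ`, DEFINED here by the projection formula
`𝖣_ψ = ‖ℙ ψ‖² = ⟪ℙ ψ, ψ⟫` (Doyon 2022 Thm 5.1: `𝖣_{a,b} = ⟨ℙ a, b⟩₀`, where Doyon's `𝖣_{a,b}` is the
Cesàro limit `lim T⁻¹ ∫₀ᵀ ⟨τ_s a, b⟩₀ ds` of §5.1; the identification of the two is von Neumann's mean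
ergodic theorem and is NOT restated here). Off-diagonal weights by polarisation. [cite: Doyon2022, §5.1 Thm 5.1] -/
def drudeWeight (ψ : D.FluctuationSpace) : ℝ := ‖D.hydroProjection ψ‖ ^ 2

/-- `𝖣_ψ = ‖ℙ ψ‖²`. [folklore] -/
theorem drudeWeight_def (ψ : D.FluctuationSpace) : D.drudeWeight ψ = ‖D.hydroProjection ψ‖ ^ 2 := rfl

/-- `𝖣_ψ = ⟪ψ, ℙ ψ⟫` (Doyon's form `⟨ℙ a, b⟩₀` on the diagonal, by symmetry of `ℙ`). [folklore] -/
theorem drudeWeight_eq_inner (ψ : D.FluctuationSpace) : D.drudeWeight ψ = ⟪ψ, D.hydroProjection ψ⟫_ℝ := by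
  rw [drudeWeight, ← real_inner_self_eq_norm_sq, hydroProjection,
    Submodule.inner_starProjection_left_eq_right, ← hydroProjection, hydroProjection_hydroProjection]

/-- `0 ≤ 𝖣_ψ`. [folklore] -/
theorem drudeWeight_nonneg (ψ : D.FluctuationSpace) : 0 ≤ D.drudeWeight ψ := sq_nonneg _

/-- **`𝖣_ψ = 0` iff `ψ ⊥ 𝒬₀`** (Mazur: no ballistic transport iff the current overlaps no conserved
charge). [folklore] -/
theorem drudeWeight_eq_zero_iff (ψ : D.FluctuationSpace) :
    D.drudeWeight ψ = 0 ↔ ψ ∈ D.conservedSpaceᗮ := by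
  rw [drudeWeight, sq_eq_zero_iff, norm_eq_zero, hydroProjection_eq_zero_iff]

/-- **Strong continuity of the Koopman group** (a property of the data, NOT asserted: Doyon 2022
Thm 4.11 (III) derives it from continuous clustering): `t ↦ U_t ψ` is continuous for every `ψ`;
under it `generator` is Stone's skew-adjoint generator `𝓛♮`. [cite: Doyon2022, §4.3 Thm 4.11] -/
def IsStronglyContinuous (D : FluctuationDynamics ν T) : Prop :=
  ∀ ψ : D.FluctuationSpace, Continuous fun t : ℝ => D.koopman t ψ

end FluctuationDynamics

/-! ## §3. `ZeroWavenumberData` and the space `ℋ₀` of the chain -/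

namespace HeatConduction

/-- **Zero-wavenumber data of the infinite chain `P` with dynamics `D`** (hypothesis structure; Doyon
2022 §4.1 Def. 4.3–4.4, Lemma 4.5, Remark 4.7, transcribed to the classical chain): a probability
measure `μ` on `ChainConfig` invariant under the lattice shifts; a shift-stable real vector space `𝒱`
of square-integrable local observables containing the bond current `j_0` and the energy density `h_0`,
with summable connected correlations `Σ_x |Cov_μ(a, b ∘ τ_x)| < ∞` and `0 ≤ Σ_x Cov_μ(a, a ∘ τ_x)`;
and stationarity/homogeneity of `D`: `μ` is carried by `D.carrier`, every `φ_t` preserves `μ`,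
`φ_t ∘ τ_x = τ_x ∘ φ_t` a.e. (automatic on a shift-invariant carrier,
`InfiniteChainDynamics.flow_comp_chainShift_ae`), and `𝒱` is stable under the flow (Doyon's `𝒱̂`,
Remark 4.7, so that clustering of `𝒱` is space-time clustering). [cite: Doyon2022, §4.1 Def. 4.3–4.4 and Remark 4.7] -/
structure ZeroWavenumberData (P : OscillatorChain) (D : InfiniteChainDynamics P) extends
    FluctuationStructure (Measure.count : Measure ℤ) chainShift where
  /-- `μ` is carried by the admissible set of the dynamics -/
  ae_mem_carrier : ∀ᵐ σ ∂μ, σ ∈ D.carrier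
  /-- stationarity: every `φ_t` preserves `μ` (includes measurability of `φ_t`) -/
  measurePreserving_flow : ∀ t : ℝ, MeasurePreserving (D.flow t) μ μ
  /-- homogeneity: `φ_t ∘ τ_x = τ_x ∘ φ_t` `μ`-a.e. -/
  flow_comm_shift : ∀ (t : ℝ) (x : ℤ), D.flow t ∘ chainShift x =ᵐ[μ] chainShift x ∘ D.flow t
  /-- `𝒱` is stable under the flow -/
  comp_flow_mem : ∀ (t : ℝ) ⦃a : ChainConfig → ℝ⦄, a ∈ localObs → a ∘ D.flow t ∈ localObs
  /-- the bond current `j_0` is a local observable -/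
  bondCurrent_mem : (fun σ => P.bondCurrentZ σ 0) ∈ localObs
  /-- the energy density `h_0` is a local observable -/
  energyDensity_mem : (fun σ => P.energyDensityZ σ 0) ∈ localObs

variable {P : OscillatorChain} {D : InfiniteChainDynamics P}

/-- **Doyon's zero-wavenumber Hilbert space `ℋ₀(μ)` of the chain**: the completion of the local
observables `𝒱` for the semi-norm `√⟨a, a⟩₀`, `⟨a, b⟩₀ = Σ_{x ∈ ℤ} Cov_μ(a, b ∘ τ_x)`
(`= FluctuationStructure.FluctuationSpace` at `G = ℤ`, `ν = count`); a real Hilbert space. [cite: Doyon2022, §4.3] -/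
abbrev ZeroWavenumberSpace (Z : ZeroWavenumberData P D) : Type := Z.FluctuationSpace

namespace ZeroWavenumberData

variable (Z : ZeroWavenumberData P D)

/-- The dynamics preserves the state in the sense of `InfiniteChainDynamics.PreservesMeasure`. [folklore] -/
theorem preservesMeasure : D.PreservesMeasure Z.μ := ⟨Z.ae_mem_carrier, Z.measurePreserving_flow⟩

/-- The data as a `FluctuationDynamics` over `(ℤ, count)` with flow `D.flow`; the a.e. group law and
`φ_0 = id` a.e. are CONSEQUENCES of `D.flow_zero`, `D.flow_add` on the (co-null) carrier. [folklore] -/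
def toFluctuationDynamics : FluctuationDynamics (Measure.count : Measure ℤ) chainShift where
  toFluctuationStructure := Z.toFluctuationStructure
  flow := D.flow
  measurePreserving_flow := Z.measurePreserving_flow
  flow_zero := by
    filter_upwards [Z.ae_mem_carrier] with σ hσ
    exact D.flow_zero σ hσ
  flow_add s t := by
    filter_upwards [Z.ae_mem_carrier] with σ hσ
    exact D.flow_add hσ s t
  flow_comm_shift := Z.flow_comm_shift
  comp_flow_mem := Z.comp_flow_mem

/-- The flow of the associated `FluctuationDynamics` is `D.flow`. [folklore] -/
@[simp] theorem toFluctuationDynamics_flow : Z.toFluctuationDynamics.flow = D.flow := rfl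

/-- The underlying static structure is unchanged. [folklore] -/
@[simp] theorem toFluctuationDynamics_toFluctuationStructure :
    Z.toFluctuationDynamics.toFluctuationStructure = Z.toFluctuationStructure := rfl

/-- Summable clustering as summability: `Σ_x |Cov_μ(a, b ∘ τ_x)| < ∞` on `𝒱`. [folklore] -/
theorem summable_cov {a b : ChainConfig → ℝ} (ha : a ∈ Z.localObs) (hb : b ∈ Z.localObs) :
    Summable fun x : ℤ => cov[a, b ∘ chainShift x; Z.μ] := by
  have h := integrable_count_iff.1 (Z.integrable_cov ha hb)
  exact h.of_norm

/-- **`⟨a, b⟩₀ = Σ_{x ∈ ℤ} Cov_μ(a, b ∘ τ_x)`** on `𝒱` (Doyon 2022 §4.1, the series `⟨a, b⟩_k =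
Σ_x e^{ikx} ⟨ι_x a, b⟩` following Def. 4.3, at `k = 0`, up to the reindexing `x ↦ -x` / symmetry; the
form of `FluctuationStructure` at the counting measure is this lattice sum). [cite: Doyon2022, §4.1 Def. 4.3] -/
theorem form_eq_tsum {a b : ChainConfig → ℝ} (ha : a ∈ Z.localObs) (hb : b ∈ Z.localObs) :
    Z.form a b = ∑' x : ℤ, cov[a, b ∘ chainShift x; Z.μ] := by
  rw [FluctuationStructure.form_def, integral_countable (Z.integrable_cov ha hb)]
  simp only [count_real_singleton, one_smul]

/-- **Stationarity of `⟨·,·⟩₀`** (the isometry property of `a ↦ a ∘ φ_t` on local observables,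
usable without the completion): `⟨a ∘ φ_t, b ∘ φ_t⟩₀ = ⟨a, b⟩₀`. [cite: Doyon2022, §3.1 eq. (3.2)] -/
theorem form_comp_flow (t : ℝ) {a b : ChainConfig → ℝ} (ha : a ∈ Z.localObs) (hb : b ∈ Z.localObs) :
    Z.form (a ∘ D.flow t) (b ∘ D.flow t) = Z.form a b :=
  Z.toFluctuationDynamics.form_comp_flow t ha hb

/-! ### The classes `[J]`, `[h]` and the Koopman group -/

/-- **The current class `[J] = [j_0] ∈ ℋ₀`** (`= [j_x]` for every `x`, `fluct_comp_shift`). [cite: Doyon2022, §4.3] -/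
def currentClass : ZeroWavenumberSpace Z := Z.fluct fun σ => P.bondCurrentZ σ 0

/-- **The energy class `[h] = [h_0] ∈ ℋ₀`**. [cite: Doyon2022, §4.3] -/
def energyClass : ZeroWavenumberSpace Z := Z.fluct fun σ => P.energyDensityZ σ 0

/-- `[J]` is the class of `j_0`. [folklore] -/
theorem currentClass_def : Z.currentClass = Z.fluct fun σ => P.bondCurrentZ σ 0 := rfl

/-- `[h]` is the class of `h_0`. [folklore] -/
theorem energyClass_def : Z.energyClass = Z.fluct fun σ => P.energyDensityZ σ 0 := rfl

/-- `[j_x] = [J]` for every bond `x` (translations act trivially on `ℋ₀`). [folklore] -/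
theorem fluct_bondCurrentZ (x : ℤ) : Z.fluct (fun σ => P.bondCurrentZ σ x) = Z.currentClass := by
  rw [← P.bondCurrentZ_comp_chainShift x]
  exact FluctuationStructure.fluct_comp_shift x Z.bondCurrent_mem

/-- `[h_x] = [h]` for every site `x`. [folklore] -/
theorem fluct_energyDensityZ (x : ℤ) : Z.fluct (fun σ => P.energyDensityZ σ x) = Z.energyClass := by
  rw [← P.energyDensityZ_comp_chainShift x]
  exact FluctuationStructure.fluct_comp_shift x Z.energyDensity_mem

/-- **The Koopman group `U_t` of the chain on `ℋ₀`** (unitary, `U_t [a] = [a ∘ φ_t]`, group law;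
`FluctuationDynamics.koopman` of the associated dynamics). [cite: Doyon2022, §4.3 Thm 4.11] -/
abbrev koopman (t : ℝ) : ZeroWavenumberSpace Z ≃ₗᵢ[ℝ] ZeroWavenumberSpace Z :=
  Z.toFluctuationDynamics.koopman t

/-- **The generator `𝓛♮`** of `U_t` on `ℋ₀` as a partially defined operator (strong derivative at `0`;
skew-symmetric on its domain; Stone's generator under `IsStronglyContinuous`). [cite: Doyon2022, §4.2 eq. (4.9)] -/
abbrev generator : ZeroWavenumberSpace Z →ₗ.[ℝ] ZeroWavenumberSpace Z :=
  Z.toFluctuationDynamics.generator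

/-- `U_t [a] = [a ∘ φ_t]` for `a ∈ 𝒱`. [cite: Doyon2022, §4.3 Thm 4.11] -/
theorem koopman_fluct (t : ℝ) {a : ChainConfig → ℝ} (ha : a ∈ Z.localObs) :
    Z.koopman t (Z.fluct a) = Z.fluct (a ∘ D.flow t) :=
  Z.toFluctuationDynamics.koopman_fluct t ha

/-- `U_t [J] = [j_0 ∘ φ_t]`. [folklore] -/
theorem koopman_currentClass (t : ℝ) :
    Z.koopman t Z.currentClass = Z.fluct ((fun σ => P.bondCurrentZ σ 0) ∘ D.flow t) :=
  Z.koopman_fluct t Z.bondCurrent_mem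

/-- **`⟪[J], U_t [J]⟫₀ = ⟨j_0, j_0 ∘ φ_t⟩₀ = Σ_x Cov_μ(j_0, j_0 ∘ φ_t ∘ τ_x)`**. [cite: Doyon2022, §4.3 Thm 4.11] -/
theorem inner_currentClass_koopman (t : ℝ) :
    ⟪Z.currentClass, Z.koopman t Z.currentClass⟫_ℝ =
      Z.form (fun σ => P.bondCurrentZ σ 0) ((fun σ => P.bondCurrentZ σ 0) ∘ D.flow t) :=
  Z.toFluctuationDynamics.inner_fluct_koopman_fluct t Z.bondCurrent_mem Z.bondCurrent_mem

/-- The summands of `⟨j_0, j_0 ∘ φ_t⟩₀` are the two-point functions of `currentCorrelation` once the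
mean current vanishes: `Cov_μ(j_0, j_0 ∘ φ_t ∘ τ_x) = ∫ j_0 · (j_x ∘ φ_t) dμ`. [folklore] -/
theorem cov_bondCurrent_flow_shift (hmean : ∫ σ, P.bondCurrentZ σ 0 ∂Z.μ = 0) (t : ℝ) (x : ℤ) :
    cov[fun σ => P.bondCurrentZ σ 0, ((fun σ => P.bondCurrentZ σ 0) ∘ D.flow t) ∘ chainShift x; Z.μ] =
      ∫ σ, P.bondCurrentZ σ 0 * P.bondCurrentZ (D.flow t σ) x ∂Z.μ := by
  have hx : (fun σ => P.bondCurrentZ σ x) ∈ Z.localObs := by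
    rw [← P.bondCurrentZ_comp_chainShift x]
    exact Z.comp_shift_mem x Z.bondCurrent_mem
  have h1 : ((fun σ => P.bondCurrentZ σ 0) ∘ D.flow t) ∘ chainShift x =ᵐ[Z.μ]
      (fun σ => P.bondCurrentZ σ x) ∘ D.flow t := by
    refine ((Z.flow_comm_shift t x).fun_comp fun σ => P.bondCurrentZ σ 0).trans ?_
    refine Eventually.of_forall fun σ => ?_
    simp only [comp_apply, P.bondCurrentZ_chainShift, zero_add]
  rw [covariance_congr_ae EventuallyEq.rfl h1,
    covariance_eq_sub (Z.memLp_of_mem Z.bondCurrent_mem) (Z.memLp_of_mem (Z.comp_flow_mem t hx)),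
    hmean, zero_mul, sub_zero]
  rfl

/-- **`⟪[J], U_t [J]⟫₀ = C(t) = D.currentCorrelation μ t`** (the space-summed current autocorrelation
of `InfiniteChainDynamics`, BLR 2000 eq. (37)), provided the mean current vanishes, `⟨j_0⟩_μ = 0`
(true under momentum-reversal symmetry, `integral_bondCurrent_eq_zero`). [cite: BonettoLebowitzReyBellet2000, §7 eq. (37)] -/
theorem inner_currentClass_koopman_eq_currentCorrelation (hmean : ∫ σ, P.bondCurrentZ σ 0 ∂Z.μ = 0)
    (t : ℝ) : ⟪Z.currentClass, Z.koopman t Z.currentClass⟫_ℝ = D.currentCorrelation Z.μ t := by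
  rw [inner_currentClass_koopman,
    Z.form_eq_tsum Z.bondCurrent_mem (Z.comp_flow_mem t Z.bondCurrent_mem)]
  exact tsum_congr fun x => Z.cov_bondCurrent_flow_shift hmean t x

/-- Under `⟨j_0⟩_μ = 0` the correlation sum of `currentCorrelation` converges absolutely at every time
(it is the clustering sum of `⟨j_0, j_0 ∘ φ_t⟩₀`): `D.HasAbsConvergentCorrelation μ t`. [folklore] -/
theorem hasAbsConvergentCorrelation (hmean : ∫ σ, P.bondCurrentZ σ 0 ∂Z.μ = 0) (t : ℝ) :
    D.HasAbsConvergentCorrelation Z.μ t := by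
  have hJt := Z.comp_flow_mem t Z.bondCurrent_mem
  refine ⟨fun x => ?_, ?_⟩
  · have hx : (fun σ => P.bondCurrentZ σ x) ∘ D.flow t ∈ Z.localObs := by
      rw [← P.bondCurrentZ_comp_chainShift x]
      exact Z.comp_flow_mem t (Z.comp_shift_mem x Z.bondCurrent_mem)
    exact (Z.memLp_of_mem Z.bondCurrent_mem).integrable_mul (Z.memLp_of_mem hx)
  · have h := integrable_count_iff.1 (Z.integrable_cov Z.bondCurrent_mem hJt)
    refine h.congr fun x => ?_
    rw [Real.norm_eq_abs, Z.cov_bondCurrent_flow_shift hmean t x]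

/-- `C(-t) = C(t)`: the current autocorrelation in `ℋ₀` is even. [folklore] -/
theorem inner_currentClass_koopman_neg (t : ℝ) :
    ⟪Z.currentClass, Z.koopman (-t) Z.currentClass⟫_ℝ = ⟪Z.currentClass, Z.koopman t Z.currentClass⟫_ℝ :=
  Z.toFluctuationDynamics.inner_koopman_neg_apply t Z.currentClass

/-- **The Drude weight of the energy current**, `𝖣_J = ‖ℙ [J]‖²` (zero iff `[J] ⊥ 𝒬₀`,
`FluctuationDynamics.drudeWeight_eq_zero_iff`; Doyon 2022 §5.1 with `a = b = j`). [cite: Doyon2022, §5.1 Thm 5.1] -/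
def currentDrudeWeight : ℝ := Z.toFluctuationDynamics.drudeWeight Z.currentClass

/-- **Conservation of the energy class** (a property of the data, not asserted): `U_t [h] = [h]` for
all `t`, i.e. `[h] ∈ 𝒬₀`. [folklore] -/
def EnergyConserved (Z : ZeroWavenumberData P D) : Prop :=
  Z.energyClass ∈ Z.toFluctuationDynamics.conservedSpace

/-- `EnergyConserved` unfolded. [folklore] -/
theorem energyConserved_iff : Z.EnergyConserved ↔ ∀ t : ℝ, Z.koopman t Z.energyClass = Z.energyClass :=
  Iff.rfl

/-! ### Momentum reversal `Θ` -/

/-- **Momentum-reversal symmetry of the data** (a property; true for an even Gibbs state with a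
reversible flow): `R` preserves `μ` and `𝒱` and reverses the flow a.e., `R ∘ φ_t = φ_{-t} ∘ R`
(automatic on a reversal-invariant carrier, `InfiniteChainDynamics.chainReversal_comp_flow_ae`);
commutation with the shifts is exact (`chainReversal_comp_chainShift`). [folklore] -/
structure HasMomentumReversal : Prop where
  /-- `R` preserves the state -/
  measurePreserving : MeasurePreserving chainReversal Z.μ Z.μ
  /-- `R` preserves the local observables -/
  comp_mem : ∀ ⦃a : ChainConfig → ℝ⦄, a ∈ Z.localObs → a ∘ chainReversal ∈ Z.localObs
  /-- `R` reverses the flow a.e. -/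
  reversal_flow : ∀ t : ℝ, chainReversal ∘ D.flow t =ᵐ[Z.μ] D.flow (-t) ∘ chainReversal

/-- Momentum reversal as a `Symmetry` of the static structure. [folklore] -/
def reversalSymmetry (h : Z.HasMomentumReversal) : Z.toFluctuationStructure.Symmetry where
  toFun := chainReversal
  measurePreserving := h.measurePreserving
  comm_shift x := Eventually.of_forall fun σ => congrFun (chainReversal_comp_chainShift x) σ
  comp_mem := h.comp_mem

/-- The reversal symmetry is `R`. [folklore] -/
@[simp] theorem coe_reversalSymmetry (h : Z.HasMomentumReversal) : ⇑(Z.reversalSymmetry h) = chainReversal :=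
  rfl

/-- **The momentum-reversal operator `Θ` on `ℋ₀`**, `Θ [a] = [a ∘ R]` (an orthogonal involution of the
real space `ℋ₀`; the anti-unitary time reversal after complexification). [folklore] -/
def reversal (h : Z.HasMomentumReversal) : ZeroWavenumberSpace Z →L[ℝ] ZeroWavenumberSpace Z :=
  (Z.reversalSymmetry h).fluctMap

/-- `Θ [a] = [a ∘ R]` for `a ∈ 𝒱`. [folklore] -/
theorem reversal_fluct (h : Z.HasMomentumReversal) {a : ChainConfig → ℝ} (ha : a ∈ Z.localObs) :
    Z.reversal h (Z.fluct a) = Z.fluct (a ∘ chainReversal) :=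
  (Z.reversalSymmetry h).fluctMap_fluct ha

/-- `Θ² = 1`. [folklore] -/
theorem reversal_reversal (h : Z.HasMomentumReversal) (ψ : ZeroWavenumberSpace Z) :
    Z.reversal h (Z.reversal h ψ) = ψ := by
  have hid : ((Z.reversalSymmetry h).comp (Z.reversalSymmetry h)).fluctMap =
      ContinuousLinearMap.id ℝ (ZeroWavenumberSpace Z) :=
    (FluctuationStructure.Symmetry.fluctMap_congr_ae _
      (FluctuationStructure.Symmetry.id Z.toFluctuationStructure)
      (Eventually.of_forall chainReversal_chainReversal)).trans
      FluctuationStructure.Symmetry.fluctMap_id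
  have e := congrArg (fun f : ZeroWavenumberSpace Z →L[ℝ] ZeroWavenumberSpace Z => f ψ) hid
  simp only [FluctuationStructure.Symmetry.fluctMap_comp, ContinuousLinearMap.comp_apply,
    ContinuousLinearMap.id_apply] at e
  exact e

/-- `Θ` preserves inner products. [folklore] -/
theorem inner_reversal_reversal (h : Z.HasMomentumReversal) (ψ φ : ZeroWavenumberSpace Z) :
    ⟪Z.reversal h ψ, Z.reversal h φ⟫_ℝ = ⟪ψ, φ⟫_ℝ :=
  (Z.reversalSymmetry h).inner_fluctMap ψ φ

/-- **`Θ [J] = -[J]`**: the current is odd. [folklore] -/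
theorem reversal_currentClass (h : Z.HasMomentumReversal) : Z.reversal h Z.currentClass = -Z.currentClass := by
  rw [currentClass_def, Z.reversal_fluct h Z.bondCurrent_mem,
    ← FluctuationStructure.fluct_neg Z.bondCurrent_mem]
  congr 1
  funext σ
  simp only [comp_apply, P.bondCurrentZ_chainReversal, Pi.neg_apply]

/-- **`Θ [h] = [h]`**: the energy is even. [folklore] -/
theorem reversal_energyClass (h : Z.HasMomentumReversal) : Z.reversal h Z.energyClass = Z.energyClass := by
  rw [energyClass_def, Z.reversal_fluct h Z.energyDensity_mem]
  congr 1
  funext σ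
  simp only [comp_apply, P.energyDensityZ_chainReversal]

/-- **`Θ U_t = U_{-t} Θ`** on `ℋ₀`. [folklore] -/
theorem reversal_koopman (h : Z.HasMomentumReversal) (t : ℝ) (ψ : ZeroWavenumberSpace Z) :
    Z.reversal h (Z.koopman t ψ) = Z.koopman (-t) (Z.reversal h ψ) := by
  have e1 : ((Z.toFluctuationDynamics.flowSymmetry t).comp (Z.reversalSymmetry h)).fluctMap =
      ((Z.reversalSymmetry h).comp (Z.toFluctuationDynamics.flowSymmetry (-t))).fluctMap := by
    refine FluctuationStructure.Symmetry.fluctMap_congr_ae _ _ ?_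
    have hR := h.reversal_flow (-t)
    rw [neg_neg] at hR
    exact hR.symm
  have e2 := congrArg (fun f : ZeroWavenumberSpace Z →L[ℝ] ZeroWavenumberSpace Z => f ψ) e1
  simp only [FluctuationStructure.Symmetry.fluctMap_comp, ContinuousLinearMap.comp_apply] at e2
  show (Z.reversalSymmetry h).fluctMap ((Z.toFluctuationDynamics.flowSymmetry t).fluctMap ψ) =
    (Z.toFluctuationDynamics.flowSymmetry (-t)).fluctMap ((Z.reversalSymmetry h).fluctMap ψ)
  exact e2

/-- Under momentum-reversal symmetry the mean current vanishes: `∫ j_0 dμ = 0`. [folklore] -/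
theorem integral_bondCurrent_eq_zero (h : Z.HasMomentumReversal) : ∫ σ, P.bondCurrentZ σ 0 ∂Z.μ = 0 := by
  have h1 := MeasurePreserving.integral_comp h.measurePreserving measurableEmbedding_chainReversal
    fun σ => P.bondCurrentZ σ 0
  simp only [P.bondCurrentZ_chainReversal, integral_neg] at h1
  linarith

/-- **`⟪[J], U_t [J]⟫₀ = D.currentCorrelation μ t`** under momentum-reversal symmetry. [cite: BonettoLebowitzReyBellet2000, §7 eq. (37)] -/
theorem inner_currentClass_koopman_eq_currentCorrelation' (h : Z.HasMomentumReversal) (t : ℝ) :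
    ⟪Z.currentClass, Z.koopman t Z.currentClass⟫_ℝ = D.currentCorrelation Z.μ t :=
  Z.inner_currentClass_koopman_eq_currentCorrelation (Z.integral_bondCurrent_eq_zero h) t

/-- `C(t)` is even under momentum-reversal symmetry: `currentCorrelation μ (-t) = currentCorrelation μ t`. [folklore] -/
theorem currentCorrelation_neg (h : Z.HasMomentumReversal) (t : ℝ) :
    D.currentCorrelation Z.μ (-t) = D.currentCorrelation Z.μ t := by
  rw [← Z.inner_currentClass_koopman_eq_currentCorrelation' h,
    ← Z.inner_currentClass_koopman_eq_currentCorrelation' h, inner_currentClass_koopman_neg]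

/-- `C(t)` is positive-definite under momentum-reversal symmetry:
`0 ≤ Σ_{i,j} c_i c_j C(t_j - t_i)` (with evenness, Bochner's hypothesis for the current spectral
measure). [folklore] -/
theorem sum_mul_currentCorrelation_nonneg (h : Z.HasMomentumReversal) {ι : Type*} (s : Finset ι)
    (c : ι → ℝ) (t : ι → ℝ) :
    0 ≤ ∑ i ∈ s, ∑ j ∈ s, c i * c j * D.currentCorrelation Z.μ (t j - t i) := by
  simp only [← Z.inner_currentClass_koopman_eq_currentCorrelation' h]
  exact Z.toFluctuationDynamics.sum_mul_inner_koopman_nonneg s c t Z.currentClass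

end ZeroWavenumberData

end HeatConduction

end Literature.MathematicalPhysics.KineticTheory
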